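import Mathlib.Analysis.SpecialFunctions.Exponential
import Mathlib.Topology.Algebra.Module.FiniteDimension
import Mathlib.LinearAlgebra.TensorProduct.Tower
import Mathlib.RingTheory.TensorProduct.Finite
import Literature.NumberTheory.Automorphic.GKModuleOfDifferentiableRep
import HarnessLib

/-!
# The standard representation of a linear real group is a `(𝔤, K)`-module

Topic `NumberTheory/Automorphic`; namespace `Literature.NumberTheory.Automorphic.RealMatrixGroup`.
Definitions with bodies and theorems; no named fact, no `sorry`.  Companion of
`GKModuleOfDifferentiableRep` (`IsDifferentiableRep`, `IsDifferentiableRep.isGKModule`).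

For a linear real group `G ≤ GL(N, A)` over a real Banach algebra `A` (`RealMatrixGroups`):

* `mulVecEndHom A N : Matrix N N A →ₐ[ℝ] End_ℝ (N → A)` (`M ↦ (v ↦ M v)`) and
  `stdAlgHom A N : Matrix N N A →ₐ[ℝ] End_ℂ (ℂ ⊗_ℝ (N → A))`, `M (c ⊗ v) = c ⊗ M v`
  (Mathlib's `Module.End.baseChangeHom`);
* `stdRep G : Representation ℂ G (ℂ ⊗_ℝ (N → A))` — **the (complexified) standard
  representation** `g (c ⊗ v) = c ⊗ g v`, and its differential
  `stdLie G : 𝔤 →ₗ⁅ℝ⁆ End_ℂ (ℂ ⊗_ℝ (N → A))`, `X (c ⊗ v) = c ⊗ X v` (`stdRep_tmul`,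
  `stdLie_tmul`);
* `isDifferentiableRep_std` — for finite-dimensional `A` **the standard representation is
  differentiable with differential `stdLie`** (coefficients are continuous real-linear functions
  of the matrix, `coeffMap`; `d/dt exp(tX)|₀ = X`, Mathlib `hasDerivAt_exp_smul_const`), hence
  `isGKModule_std` — **restricted to `K`, with `stdLie`, it is a `(𝔤, K)`-module**
  [cite: BorelWallach2000, 0 §2.3–2.5] — the building block (with tensor products
  `GKModuleTensor`, duals `GKContragredient`, subquotients `GKSubquotient`) of the
  finite-dimensional coefficient systems `E` of `H^q(𝔤, K; V ⊗ E)` [cite: BorelWallach2000, I §5.1].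

## Mathlib / Literature search

`Module.End.baseChangeHom`, `LinearMap.baseChange_tmul`, `hasDerivAt_exp_smul_const`,
`LinearMap.continuous_of_finiteDimensional`, `LinearMap.toContinuousLinearMap`,
`Module.Finite.base_change` (Mathlib) are used; the matrix operator norm is the scoped
`Matrix.Norms.Operator` (as in `ArchCoordinatesGL`). No standard-representation `(𝔤, K)`-module
exists in the tree (`lean search 'stdRep|stdLie|mulVecEndHom'`: no hits).

## References

* A. Borel, N. Wallach (2000), 0 §2.3–2.5, I §5.1 (held) [BorelWallach2000].
-/

noncomputable section

namespace Literature.NumberTheory.Automorphic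

open Module

-- Mathlib idiom (as in `GKModules`): commutator bracket on `Module.End`
attribute [local instance 100] LieRing.ofAssociativeRing

open scoped MatrixGroups Matrix

variable {A : Type*} [NormedCommRing A] [NormedAlgebra ℝ A] [NormedAlgebra ℚ A] [CompleteSpace A]
  [StarRing A] {N : Type*} [Fintype N] [DecidableEq N] (G : RealMatrixGroup A N)

namespace RealMatrixGroup

section Standard

open TensorProduct NormedSpace
open scoped Matrix.Norms.Operator

variable (A N)

omit [NormedAlgebra ℚ A] [CompleteSpace A] [StarRing A] in
/-- `M ↦ (v ↦ M v)`: the matrix algebra acting on column vectors, as a morphism of real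
algebras `Matrix N N A → End_ℝ (N → A)`. [folklore] -/
def mulVecEndHom : Matrix N N A →ₐ[ℝ] Module.End ℝ (N → A) where
  toFun M := (Matrix.mulVecLin M).restrictScalars ℝ
  map_one' := by
    refine LinearMap.ext fun v => ?_
    simp only [LinearMap.restrictScalars_apply, Matrix.mulVecLin_apply, Matrix.one_mulVec,
      Module.End.one_apply]
  map_mul' M M' := by
    refine LinearMap.ext fun v => ?_
    simp only [LinearMap.restrictScalars_apply, Matrix.mulVecLin_apply, Module.End.mul_apply,
      Matrix.mulVec_mulVec]
  map_zero' := by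
    refine LinearMap.ext fun v => ?_
    simp only [LinearMap.restrictScalars_apply, Matrix.mulVecLin_apply, Matrix.zero_mulVec,
      LinearMap.zero_apply]
  map_add' M M' := by
    refine LinearMap.ext fun v => ?_
    simp only [LinearMap.restrictScalars_apply, Matrix.mulVecLin_apply, Matrix.add_mulVec,
      LinearMap.add_apply]
  commutes' r := by
    refine LinearMap.ext fun v => funext fun i => ?_
    simp only [LinearMap.restrictScalars_apply, Matrix.mulVecLin_apply,
      Matrix.algebraMap_eq_diagonal, Matrix.mulVec_diagonal, Pi.algebraMap_apply,
      Module.algebraMap_end_apply, Pi.smul_apply, Algebra.smul_def]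

omit [NormedAlgebra ℚ A] [CompleteSpace A] [StarRing A] in
/-- Unfolding. [folklore] -/
@[simp] theorem mulVecEndHom_apply (M : Matrix N N A) (v : N → A) :
    mulVecEndHom A N M v = M *ᵥ v := rfl

/-- The matrix algebra acting on the complexified column vectors `ℂ ⊗_ℝ (N → A)`:
`M (c ⊗ v) = c ⊗ M v`, a morphism of real algebras (`Module.End.baseChangeHom`). [folklore] -/
def stdAlgHom : Matrix N N A →ₐ[ℝ] Module.End ℂ (ℂ ⊗[ℝ] (N → A)) :=
  (Module.End.baseChangeHom ℝ ℂ (N → A)).comp (mulVecEndHom A N)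

omit [NormedAlgebra ℚ A] [CompleteSpace A] [StarRing A] in
/-- Unfolding on pure tensors. [folklore] -/
@[simp] theorem stdAlgHom_tmul (M : Matrix N N A) (c : ℂ) (v : N → A) :
    stdAlgHom A N M (c ⊗ₜ v) = c ⊗ₜ (M *ᵥ v) := rfl

variable {A N}

/-- **The standard representation** of `G ≤ GL(N, A)` on `ℂ ⊗_ℝ (N → A)`: `g (c ⊗ v) = c ⊗ g v`.
[cite: BorelWallach2000, 0 §2.3] -/
def stdRep : Representation ℂ G.carrier (ℂ ⊗[ℝ] (N → A)) :=
  (stdAlgHom A N).toMonoidHom.comp ((Units.coeHom (Matrix N N A)).comp G.carrier.subtype)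

/-- Unfolding on pure tensors. [folklore] -/
@[simp] theorem stdRep_tmul (g : G.carrier) (c : ℂ) (v : N → A) :
    stdRep G g (c ⊗ₜ v) = c ⊗ₜ (((g : GL N A) : Matrix N N A) *ᵥ v) := rfl

/-- The differential of the standard representation: `X (c ⊗ v) = c ⊗ X v` for `X ∈ 𝔤`.
[cite: BorelWallach2000, 0 §2.3] -/
def stdLie : G.lie →ₗ⁅ℝ⁆ Module.End ℂ (ℂ ⊗[ℝ] (N → A)) :=
  (stdAlgHom A N).toLieHom.comp G.lie.incl

/-- Unfolding on pure tensors. [folklore] -/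
@[simp] theorem stdLie_tmul (X : G.lie) (c : ℂ) (v : N → A) :
    stdLie G X (c ⊗ₜ v) = c ⊗ₜ ((X : Matrix N N A) *ᵥ v) := rfl

omit [NormedAlgebra ℚ A] [CompleteSpace A] [StarRing A] [DecidableEq N] in
/-- `c ⊗ (· *ᵥ v)` followed by a functional: the real-linear map `M ↦ ℓ (c ⊗ M v)` on matrices.
[folklore] -/
def coeffMap (ℓ : Dual ℂ (ℂ ⊗[ℝ] (N → A))) (c : ℂ) (v : N → A) : Matrix N N A →ₗ[ℝ] ℂ where
  toFun M := ℓ (c ⊗ₜ (M *ᵥ v))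
  map_add' M M' := by rw [Matrix.add_mulVec, tmul_add, map_add]
  map_smul' t M := by
    rw [Matrix.smul_mulVec, tmul_smul, LinearMap.map_smul_of_tower, RingHom.id_apply]

omit [NormedAlgebra ℚ A] [CompleteSpace A] [StarRing A] [DecidableEq N] in
/-- Unfolding. [folklore] -/
@[simp] theorem coeffMap_apply (ℓ : Dual ℂ (ℂ ⊗[ℝ] (N → A))) (c : ℂ) (v : N → A)
    (M : Matrix N N A) : coeffMap ℓ c v M = ℓ (c ⊗ₜ (M *ᵥ v)) := rfl

variable [FiniteDimensional ℝ A]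

/-- **The standard representation is differentiable** with differential `stdLie`: on pure
tensors the coefficient `g ↦ ℓ (c ⊗ g v)` is a (continuous, `A` being finite-dimensional)
real-linear function of the matrix `g`, and `d/dt exp(tX) = X` at `0`
(`hasDerivAt_exp_smul_const`). [cite: BorelWallach2000, 0 §2.3] -/
theorem isDifferentiableRep_std : IsDifferentiableRep G (stdRep G) (stdLie G) where
  continuous_coeff v ℓ := by
    induction v using TensorProduct.induction_on with
    | zero => simp only [map_zero]; exact continuous_const
    | tmul c w =>
      have hc : Continuous (coeffMap ℓ c w) := LinearMap.continuous_of_finiteDimensional _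
      exact hc.comp (Units.continuous_val.comp continuous_subtype_val)
    | add x y hx hy => simp only [map_add]; exact hx.add hy
  hasDerivAt_coeff X v ℓ := by
    induction v using TensorProduct.induction_on with
    | zero => simp only [map_zero]; exact hasDerivAt_const 0 0
    | tmul c w =>
      have hexp : HasDerivAt (fun t : ℝ ↦ exp (t • (X : Matrix N N A))) (X : Matrix N N A) 0 := by
        have h := hasDerivAt_exp_smul_const (𝕂 := ℝ) (X : Matrix N N A) 0
        rwa [zero_smul, exp_zero, one_mul] at h
      have h := ((coeffMap ℓ c w).toContinuousLinearMap.hasFDerivAt).comp_hasDerivAt (0 : ℝ) hexp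
      exact h
    | add x y hx hy => simp only [map_add]; exact hx.add hy

variable [StarModule ℝ A] [ContinuousStar A]

/-- The standard representation of `G` restricted to `K`, with its differential, **is a
`(𝔤, K)`-module**. [cite: BorelWallach2000, 0 §2.4–2.5] -/
theorem isGKModule_std : IsGKModule G (restrictK G (stdRep G)) (stdLie G) :=
  haveI : FiniteDimensional ℂ (ℂ ⊗[ℝ] (N → A)) := Module.Finite.base_change ℝ ℂ (N → A)
  (isDifferentiableRep_std G).isGKModule

end Standard

end RealMatrixGroup

end Literature.NumberTheory.Automorphic
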